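import Summits.BirchSwinnertonDyer.BirchSwinnertonDyer.Theorems.ManinLocalTwoThreeEtaParityFortyFour
import Summits.BirchSwinnertonDyer.BirchSwinnertonDyer.Theorems.ManinLocalTwoThreePinningEightyEight
import Literature.NumberTheory.EllipticCurves.NewformsLevelRaising
import HarnessLib

/-!
# `Φ₄₄` IS (the underlying function of) A CUSP FORM on `Γ₀(44)` — datum-free, via two cuspidal `η`-quotients of level `88`

Cell `bsd-f2-manin`, route `ManinLocalTwoThree`, crux C2 `ManinOddAtFour` (stmt-BirchSwinnertonDyer-22967); prover seat p2 gen 31; `--supports`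
(helper).  PURPOSE: an g55's level-`176` row file (`…PinningOneSeventySixRows`) and desc's `χ₋₄`-transport to `176c`
(`TwistDefect.abs_maninConstant_eq_one_oneSeventySixC_of_cuspCoeff`) both take a ROOT CUSP FORM `φ ∈ S₂(Γ₀(44))` with `⇑φ = ⇑Φ₄₄`;
the tree only produces one from an `X₀(44)`-datum (`NewformPinningFortyFour.f_apply_eq_phi44 D₀`, i.e. modularity of `44a1`).  Here it is
constructed UNCONDITIONALLY: `exists_cuspForm_phi44 : ∃ φ : CuspForm (Gamma0 44) 2, ⇑φ = ⇑Φ₄₄`.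

THE IDENTITY (found by exact linear algebra over the nine CUSPIDAL even-supported weight-2 `η`-quotients of level `88`, verified to `q²²⁰`,
proved here by Sturm in `M₂(Γ₀(88))`: bound `⌊2·144/12⌋ = 24`, twenty-five coefficients):
**`Φ₄₄ = R₁ + 4·R₂`**, `R₁ = η₄⁵η₄₄⁵/(η₂η₈²η₂₂η₈₈²)`, `R₂ = η₂η₈²η₂₂η₈₈²/(η₄η₄₄)` — both CUSP forms on `Γ₀(88)` (Ligozat orders
`2,2,7,1,2,2,7,1` resp. `2,2,1,7,2,2,1,7` at the eight cusps, `> 0`; `EtaCert` by `decide`, the tree's `etaQuotientCuspForm`).  Hence `Φ₄₄`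
vanishes at every cusp (the cusps of `Γ₀(44)` and of `Γ₀(88)` are both all of `ℙ¹(ℚ)`, `Subgroup.IsArithmetic.isCusp_iff_isCusp_SL2Z`), and
`Φ₄₄` with its own `Γ₀(44)`-invariance is a cusp form of level `44`.
HONEST FRAMING: unconditional, standard axioms; an identity in `M₂(Γ₀(88))` — no Hecke theory; nothing here proves C2, Manin's conjecture or BSD.
[cite: Ligozat1975, Ch. 3] [cite: Koehler2011, §2.1] [cite: Sturm1987, Thm. 1] [cite: CremonaAlgorithms1997, Table 3 (N = 44)]
[cite: DiamondShurman2005, §5.6]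
-/

set_option autoImplicit false
-- lint-debt: the directory name repeats the summit name (sibling precedent `ManinLocalTwoThreeEtaParityFortyFour.lean`)
set_option linter.dupNamespace false

noncomputable section

open Complex Filter Topology
open UpperHalfPlane hiding I
open scoped Real Topology Manifold MatrixGroups ModularForm
open ModularForm CongruenceSubgroup PowerSeries
open Literature.NumberTheory.ModularForms
open Literature.NumberTheory.EllipticCurves Literature.NumberTheory.EllipticCurves.ModularForms

namespace Summit.BirchSwinnertonDyer.BirchSwinnertonDyer.Theorems.ManinLocalTwoThree.LevelFortyFour

open EtaParity BracketSturm PinningKernel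

/-! ## §1 The two cuspidal `η`-quotients of level `88` -/

/-- Exponent list of `R₁ = η₄⁵η₄₄⁵/(η₂η₈²η₂₂η₈₈²)`. [folklore] -/
def lR1 : List (ℕ × ℤ) := [(2, -1), (4, 5), (8, -2), (22, -1), (44, 5), (88, -2)]

/-- Exponent list of `R₂ = η₂η₈²η₂₂η₈₈²/(η₄η₄₄)`. [folklore] -/
def lR2 : List (ℕ × ℤ) := [(2, 1), (4, -1), (8, 2), (22, 1), (44, -1), (88, 2)]

/-- `R₁` is an `η`-quotient cusp form of weight `2` on `Γ₀(88)` (`∏ δ^|r_δ| = 1919025152²`). [cite: Ligozat1975, Ch. 3] -/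
theorem etaCert_R1 : EtaCert 88 lR1 1919025152 := by unfold lR1; decide

/-- `R₂` is an `η`-quotient cusp form of weight `2` on `Γ₀(88)` (`∏ δ^|r_δ| = 61952²`). [cite: Ligozat1975, Ch. 3] -/
theorem etaCert_R2 : EtaCert 88 lR2 61952 := by unfold lR2; decide

/-- `R₁ ∈ M₂(Γ₀(88))`. [cite: Ligozat1975, Ch. 3] -/
def R1m : ModularForm (Gamma0 88) 2 :=
  etaQuotientModularForm 88 (expFn lR1) 2 (by decide) (newmanCond_of_etaCert etaCert_R1) fun c hc ↦ le_of_lt (etaCert_R1.2.2.2.2 c hc)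

/-- `R₂ ∈ M₂(Γ₀(88))`. [cite: Ligozat1975, Ch. 3] -/
def R2m : ModularForm (Gamma0 88) 2 :=
  etaQuotientModularForm 88 (expFn lR2) 2 (by decide) (newmanCond_of_etaCert etaCert_R2) fun c hc ↦ le_of_lt (etaCert_R2.2.2.2.2 c hc)

/-- `R₁ ∈ S₂(Γ₀(88))`. [cite: Ligozat1975, Ch. 3] -/
def R1c : CuspForm (Gamma0 88) 2 :=
  etaQuotientCuspForm 88 (expFn lR1) 2 (by decide) (newmanCond_of_etaCert etaCert_R1) etaCert_R1.2.2.2.2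

/-- `R₂ ∈ S₂(Γ₀(88))`. [cite: Ligozat1975, Ch. 3] -/
def R2c : CuspForm (Gamma0 88) 2 :=
  etaQuotientCuspForm 88 (expFn lR2) 2 (by decide) (newmanCond_of_etaCert etaCert_R2) etaCert_R2.2.2.2.2

/-- `R₁(τ)` pointwise. [folklore] -/
theorem R1m_apply (τ : ℍ) : R1m τ = etaQuotient 88 (expFn lR1) τ := rfl
/-- `R₂(τ)` pointwise. [folklore] -/
theorem R2m_apply (τ : ℍ) : R2m τ = etaQuotient 88 (expFn lR2) τ := rfl
/-- `R₁(τ)` pointwise (cusp form). [folklore] -/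
theorem R1c_apply (τ : ℍ) : R1c τ = etaQuotient 88 (expFn lR1) τ := rfl
/-- `R₂(τ)` pointwise (cusp form). [folklore] -/
theorem R2c_apply (τ : ℍ) : R2c τ = etaQuotient 88 (expFn lR2) τ := rfl

/-! ## §2 Coefficient tables to depth `25` (sparse kernel `η`-certificates) -/

/-- The first `25` coefficients of `R₁`. [cite: Koehler2011, §2.1] -/
def tabR1 : List ℤ := [0, 1, 0, 1, 0, -3, 0, -2, 0, 2, 0, -1, 0, 0, 0, 1, 0, 2, 0, 4, 0, -2, 0, 1, 0]
/-- The first `25` coefficients of `R₂`. [cite: Koehler2011, §2.1] -/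
def tabR2 : List ℤ := [0, 0, 0, 0, 0, 0, 0, 1, 0, -1, 0, 0, 0, -1, 0, -1, 0, 1, 0, 1, 0, 1, 0, -1, 0]

/-- `Σ δ·r_δ = 24` for `R₁`. [folklore] -/
theorem sum_lR1 : ∑ δ ∈ (88 : ℕ).divisors, (δ : ℤ) * expFn lR1 δ = 24 * (1 : ℕ) := by unfold lR1; decide
/-- `Σ δ·r_δ = 168` for `R₂`. [folklore] -/
theorem sum_lR2 : ∑ δ ∈ (88 : ℕ).divisors, (δ : ℤ) * expFn lR2 δ = 24 * (7 : ℕ) := by unfold lR2; decide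

/-- Sparse kernel `η`-certificate of `R₁` to depth `25`. [cite: Koehler2011, §2.1] -/
theorem hcertR1 : mulList 25 tabR1 (etaDenListSparse 25 88 (expFn lR1)) = etaNumListSparse 25 88 (expFn lR1) 1 := by
  unfold lR1; decide +kernel
/-- Sparse kernel `η`-certificate of `R₂` to depth `25`. [cite: Koehler2011, §2.1] -/
theorem hcertR2 : mulList 25 tabR2 (etaDenListSparse 25 88 (expFn lR2)) = etaNumListSparse 25 88 (expFn lR2) 7 := by
  unfold lR2; decide +kernel

/-- The coefficients `a₀, …, a₂₄` of `R₁`. [cite: Koehler2011, §2.1] -/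
theorem coeff_R1m : ∀ n < 25, ((tabR1.getD n 0 : ℤ) : ℂ) = (qExpansion 1 ⇑R1m).coeff n :=
  qExpansion_coeff_eq_of_etaCertificateSparse R1m (expFn lR1) R1m_apply 1 sum_lR1 tabR1 hcertR1
/-- The coefficients `a₀, …, a₂₄` of `R₂`. [cite: Koehler2011, §2.1] -/
theorem coeff_R2m : ∀ n < 25, ((tabR2.getD n 0 : ℤ) : ℂ) = (qExpansion 1 ⇑R2m).coeff n :=
  qExpansion_coeff_eq_of_etaCertificateSparse R2m (expFn lR2) R2m_apply 7 sum_lR2 tabR2 hcertR2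

/-! ## §3 `Φ₄₄` as a modular form of level `88`, and the identity `Φ₄₄ = R₁ + 4·R₂` in `M₂(Γ₀(88))` -/

/-- **`Φ₄₄` viewed in `M₂(Γ₀(88))`** (same function; `Γ₀(88) ≤ Γ₀(44)`, every cusp of `Γ₀(88)` is a cusp of `Γ₀(44)`).
[cite: DiamondShurman2005, §5.6] -/
def Phi44L88 : ModularForm (Gamma0 88) 2 where
  toFun := Phi44
  slash_action_eq' γ hγ := SlashInvariantFormClass.slash_action_eq Phi44 γ (Gamma0GL_le_of_dvd (⟨2, rfl⟩ : 44 ∣ 88) hγ)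
  holo' := Phi44.holo'
  bdd_at_cusps' hc := Phi44.bdd_at_cusps' (hc.mono (Gamma0GL_le_of_dvd (⟨2, rfl⟩ : 44 ∣ 88)))

/-- `Φ₄₄|₈₈(τ) = Φ₄₄(τ)`. [folklore] -/
theorem Phi44L88_apply (τ : ℍ) : Phi44L88 τ = Phi44 τ := rfl

/-- **`Φ₄₄ = R₁ + 4·R₂` in `M₂(Γ₀(88))`** (Sturm, `25` coefficients). [cite: Sturm1987, Thm. 1] [cite: CremonaAlgorithms1997, Table 3 (N = 44)] -/
theorem Phi44L88_eq : Phi44L88 = R1m + (4 : ℂ) • R2m := by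
  rw [← sub_eq_zero]
  refine modularForm_eq_zero_of_coeff_eq_zero _ (m := 25) (fun i hi ↦ ?_) (by rw [PinningEightyEight.gamma0_data_88.1]; decide)
  have h1 := coeff_R1m i hi
  have h2 := coeff_R2m i hi
  have hi' : i ≤ 33 := by omega
  change modCoefₗ 88 2 i (Phi44L88 - (R1m + (4 : ℂ) • R2m)) = 0
  rw [map_sub, map_add, map_smul]
  change (qExpansion 1 ⇑Phi44).coeff i - ((qExpansion 1 ⇑R1m).coeff i + (4 : ℂ) • (qExpansion 1 ⇑R2m).coeff i) = 0
  rw [coeff_Phi44 i hi', ← h1, ← h2]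
  simp only [tabR1, tabR2, smul_eq_mul]
  interval_cases i <;> norm_num

/-- **`Φ₄₄(τ) = R₁(τ) + 4·R₂(τ)`** pointwise. [folklore] -/
theorem Phi44_apply_eq_R (τ : ℍ) : Phi44 τ = etaQuotient 88 (expFn lR1) τ + 4 * etaQuotient 88 (expFn lR2) τ := by
  rw [← Phi44L88_apply, Phi44L88_eq]
  simp only [ModularForm.add_apply, ModularForm.IsGLPos.smul_apply, smul_eq_mul]
  rw [R1m_apply, R2m_apply]

/-- `⇑(R₁ + 4·R₂) = ⇑Φ₄₄` as functions (cusp-form side). [folklore] -/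
theorem coe_R_eq_Phi44 : (⇑(R1c + (4 : ℂ) • R2c) : ℍ → ℂ) = ⇑Phi44 := by
  funext τ
  rw [Phi44_apply_eq_R, CuspForm.add_apply, CuspForm.IsGLPos.smul_apply, smul_eq_mul, R1c_apply, R2c_apply]

/-! ## §4 `Φ₄₄` is a cusp form of level `44` -/

/-- **A CUSP FORM ON `Γ₀(44)` WITH UNDERLYING FUNCTION `Φ₄₄` EXISTS** — unconditionally (no `X₀(44)`-datum, no modularity).
[cite: DiamondShurman2005, §5.6] [cite: CremonaAlgorithms1997, Table 3 (N = 44)] -/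
theorem exists_cuspForm_phi44 : ∃ φ : CuspForm (Gamma0 44) 2, (⇑φ : ℍ → ℂ) = ⇑Phi44 := by
  refine ⟨{ toFun := Phi44
            slash_action_eq' := fun γ hγ ↦ SlashInvariantFormClass.slash_action_eq Phi44 γ hγ
            holo' := Phi44.holo'
            zero_at_cusps' := fun {c} hc ↦ ?_ }, rfl⟩
  have hc88 : IsCusp c ((Gamma0 88 : Subgroup SL(2, ℤ)) : Subgroup (GL (Fin 2) ℝ)) := by
    rw [Subgroup.IsArithmetic.isCusp_iff_isCusp_SL2Z] at hc ⊢
    exact hc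
  have h := (R1c + (4 : ℂ) • R2c).zero_at_cusps' hc88
  rw [show (R1c + (4 : ℂ) • R2c).toFun = ⇑(R1c + (4 : ℂ) • R2c) from rfl, coe_R_eq_Phi44] at h
  exact h

end Summit.BirchSwinnertonDyer.BirchSwinnertonDyer.Theorems.ManinLocalTwoThree.LevelFortyFour

end
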